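import Summits.BirchSwinnertonDyer.BirchSwinnertonDyer.Theorems.SmallImageMuTransferMuTransferX9LocalCocycleValues
import Summits.BirchSwinnertonDyer.BirchSwinnertonDyer.Theorems.SmallImageMuTransferMuTransferX9LocalSplitValues
import Summits.BirchSwinnertonDyer.BirchSwinnertonDyer.Theorems.SmallImageMuTransferMuTransferX9LocalTransversePerfect
import HarnessLib

/-!
# K6 crux `MuTransferX9` (stmt-BirchSwinnertonDyer-19276), CORE-PLAN S4.3 on the genuine objects, file 3/5:
# (N3) `tr × ur` PERFECTNESS transported to k6-ty's twist/Gorenstein currency along `twistDualMap`, and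
# (N1) NATURALITY of the local cup product for `e`-adjoint pairs of coordinate endomorphisms

Cell `bsd-smallim`, seat `bsd-smallim-koly` gen 8 (route `SmallImageMuTransfer`, rung K6, leaf
`Rank1Residual.BSDpOnClassX9`). HONEST FRAMING: TOOL theorems; no definition, no named fact, no `sorry`;
nothing is asserted about any curve and nothing is booked. Serves the registered stub `stub_stepsTwoFourX9`
of crux 19276 (skeleton v5 bbfcbeb8eb041500; the q-TERM of MU-TRANSFER-PROOF §5 STEP 4 = Lemma 1 (iii))
and credits nothing toward its closure (`--supports … --as helper`). PARTITION (D-0054): X9 (A4) ×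
p ∈ {5, 7} · X10b∧¬Surj (A5) × p = 3 (everything is stated for an odd prime / any number field) — helper;
closes NONE.

## Content (a number field `K`, odd `p`, `𝒯_J = κ.twistModP ρ J`, `𝒯′_J = κ⁻¹.twistModP ρ′ J`, a finite
place `q ∤ p` with `ρ`, `ρ′` unramified, `p ∣ N(q) − 1`, `χ̄_ℓ` onto on inertia; `P` ANY local continuous
pairing `𝒯_J|_q × 𝒯′_J|_q → μ_p|_q` whose bilinear map is the Gorenstein pairing `C_(J−1)` of `e`)
* **`exists_unramified_cupProduct_ne_zero_of_transverse`** — for `e` PERFECT and a family `inv` with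
  `inv.IsPerfect`: a NON-ZERO transverse class of `𝒯_J|_q` has `inv_q(c ∪_P [ψ]) ≠ 0` for some cocycle
  `ψ` of `𝒯′_J|_q` vanishing on inertia (koly g7's `eq_zero_of_mem_transverse_of_forall_unramified_pairing
  _eq_zero` + `cupProduct_adjoint` along `D = twistDualMap|_(Γ_(K_q))`, bijective, and its inverse).
* **`cupProduct_iterate_eq_of_adjoint`** — at an `E`-SPLIT Frobenius (so that every `φ₀ : M →+ M` is
  equivariant on `𝒯_J|_q`, koly g7 `toLocal_twistModP_comp_endo`): if `e(φ₀ a, b) = e(a, φ₀′ b)` then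
  `T^i[φ₂] ∪_P [ψ₁] = T^i[φ₁] ∪_P [ψ₂]` whenever `φ₂(t₀) = φ₀ ∘ φ₁(t₀)` (transverse) and
  `ψ₂(Fr) = φ₀′ ∘ ψ₁(Fr)` (unramified).

References: B. Mazur, K. Rubin, Mem. AMS 799 (2004) Prop. 1.3.2 [MazurRubin2004]; J. S. Milne, *ADT*
(2006) I Cor. 2.3 [MilneADT2006]; J. Neukirch, A. Schmidt, K. Wingberg (2008) I §4 (1.4.2)
[NeukirchSchmidtWingberg2008].
-/

set_option linter.dupNamespace false
set_option autoImplicit false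

noncomputable section

open scoped Classical ContRepresentation

universe u

namespace Summit.BirchSwinnertonDyer.BirchSwinnertonDyer.Rank1Residual.LocalSplitPrime

open CategoryTheory ContinuousCohomology Function Field ValuativeRel NumberField IsDedekindDomain Finset
open Literature.NumberTheory.GaloisRepresentations
open Literature.NumberTheory.GaloisRepresentations.IsNonarchimedeanLocalField
open _root_.TopRep
open Literature.NumberTheory.GaloisCohomology
open Literature.NumberTheory.EllipticCurves
open Summit.BirchSwinnertonDyer.Rank1Residual.GaloisImage
open Summit.BirchSwinnertonDyer.Rank1Residual (X11b.LocBridge.mem_unramifiedSubgroup_one_iff_forall_eq_zero)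

section QTerm

variable {K : Type u} [Field K] [NumberField K] {p : ℕ} [Fact p.Prime]
  {M M' : Type u} [AddCommGroup M] [TopologicalSpace M] [DiscreteTopology M] [Finite M]
  [AddCommGroup M'] [TopologicalSpace M'] [DiscreteTopology M'] [Finite M']
  (ρ : DiscreteGaloisModule K M) (ρ' : DiscreteGaloisModule K M')
  (hM : ∀ x : M, p • x = 0) (hM' : ∀ x : M', p • x = 0) (κ : ZpExtension K p) (J : ℕ)
  (q : HeightOneSpectrum (𝓞 K)) [Fact (Ideal.absNorm q.asIdeal).Prime]
  [NeZero ((Ideal.absNorm q.asIdeal : ℕ) : q.adicCompletion K)]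

-- cup products on `Γ_{K_q}` need `LocallyCompactSpace`; as in the tree's `LocalTatePairing.lean`
attribute [local instance] absoluteGaloisGroup_compactSpace
omit [Finite M'] in
/-- **`tr × ur` perfectness in the twist/`B`-currency** (KOLY-MEMO §5.11.B (N3) transported along
k6-ty's `twistDualMap : 𝒯′_J → 𝒯_J^D`, bijective for a perfect `e`): a NON-ZERO transverse class of
`𝒯_J|_q` pairs non-trivially, through any local pairing `P` with bilinear map the Gorenstein pairing,
with some UNRAMIFIED cocycle of `𝒯′_J|_q`. [cite: MazurRubin2004, Prop. 1.3.2 (p. 12)]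
[cite: MilneADT2006, Ch. I, Cor. 2.3] -/
theorem exists_unramified_cupProduct_ne_zero_of_transverse (hp : p ≠ 2)
    {e : M →+ M' →+ DiscreteGaloisModule.MuCarrier K p}
    (he : ∀ (g : absoluteGaloisGroup K) (a : M) (b : M'),
      e (ρ g a) (ρ' g b) = DiscreteGaloisModule.mu K p g (e a b))
    (hnd : ∀ b : M', (∀ a : M, e a b = 0) → b = 0)
    (hsurj : ∀ χ : M →+ DiscreteGaloisModule.MuCarrier K p, ∃ b : M', ∀ a, e a b = χ a)
    (hunr : GaloisRep.IsUnramifiedAt q ρ) (hunr' : GaloisRep.IsUnramifiedAt q ρ')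
    (hqp : (p : 𝓞 K) ∉ q.asIdeal) (hpl : p ∣ Ideal.absNorm q.asIdeal - 1)
    (hχI : ∀ u : (ZMod (Ideal.absNorm q.asIdeal))ˣ, ∃ t ∈ absInertia (q.adicCompletion K),
      modPCyclotomicCharacterZMod (q.adicCompletion K) (Ideal.absNorm q.asIdeal) t = u)
    (inv : LocalInvariants K p) (hperf : inv.IsPerfect)
    (P : ContPairing (GaloisRep.toLocal q (κ.twistModP ρ hM J)).toTopRep
      (GaloisRep.toLocal q (κ.invTwist.twistModP ρ' hM' J)).toTopRep
      ((DiscreteGaloisModule.mu K p).toLocal (Sum.inr q)).toTopRep)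
    (hP : ∀ x y, P.toLin x y = gorensteinPairing e J x y)
    {c : galoisCohomology (GaloisRep.toLocal q (κ.twistModP ρ hM J)) 1}
    (hc : c ∈ DiscreteGaloisModule.transverseSubgroup (GaloisRep.toLocal q (κ.twistModP ρ hM J))
      (CyclotomicField (Ideal.absNorm q.asIdeal) (q.adicCompletion K)))
    (hc0 : c ≠ 0) :
    ∃ ψ : contOneCocycles (GaloisRep.toLocal q (κ.invTwist.twistModP ρ' hM' J)).toTopRep,
      (∀ t ∈ absInertia (q.adicCompletion K), ψ.1 t = 0) ∧
        inv (Sum.inr q) (P.cupProduct c (oneCocycleClass _ ψ)) ≠ 0 := by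
  classical
  by_contra hcon
  have hcon' : ∀ ψ : contOneCocycles (GaloisRep.toLocal q (κ.invTwist.twistModP ρ' hM' J)).toTopRep,
      (∀ t ∈ absInertia (q.adicCompletion K), ψ.1 t = 0) →
        inv (Sum.inr q) (P.cupProduct c (oneCocycleClass _ ψ)) = 0 :=
    fun ψ hψ => by by_contra h; exact hcon ⟨ψ, hψ, h⟩
  have hp2 : Odd p := (Fact.out : p.Prime).odd_of_ne_two hp
  have hchar := ringChar_residueField_adicCompletion_eq q
  have hI : ∀ t ∈ absInertia (q.adicCompletion K), ∀ x : Fin J → M,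
      GaloisRep.toLocal q (κ.twistModP ρ hM J) t x = x :=
    fun _ ht x => toLocal_twistModP_apply_of_mem_absInertia ρ hM κ J q hunr hqp ht x
  have hI' : ∀ t ∈ absInertia (q.adicCompletion K), ∀ y : Fin J → M',
      GaloisRep.toLocal q (κ.invTwist.twistModP ρ' hM' J) t y = y :=
    fun _ ht y => toLocal_twistModP_apply_of_mem_absInertia ρ' hM' κ.invTwist J q hunr' hqp ht y
  have hℓM : ∀ x : Fin J → M, (Ideal.absNorm q.asIdeal - 1) • x = 0 := sub_one_smul_eq_zero_of_dvd hM hpl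
  -- `D = twistDualMap` on the local modules, and its inverse
  have hDgeq : ∀ (g : absoluteGaloisGroup (q.adicCompletion K)) (y : Fin J → M'),
      κ.twistDualMap ρ ρ' p hM hM' J he (GaloisRep.toLocal q (κ.invTwist.twistModP ρ' hM' J) g y) =
        GaloisRep.toLocal q ((κ.twistModP ρ hM J).tateDual p) g (κ.twistDualMap ρ ρ' p hM hM' J he y) :=
    fun g y => ContinuousLinearMap.ext_iff.1
      ((κ.twistDualMap ρ ρ' p hM hM' J he).isIntertwining' (absGaloisRestrict K (q.adicCompletion K) g)) y
  obtain ⟨Dl, hDlg⟩ := exists_contIntertwiningMap_of_comm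
    (GaloisRep.toLocal q (κ.invTwist.twistModP ρ' hM' J)) (GaloisRep.toLocal q ((κ.twistModP ρ hM J).tateDual p))
    (κ.twistDualMap ρ ρ' p hM hM' J he).toContinuousLinearMap.toLinearMap.toAddMonoidHom (fun g y => hDgeq g y)
  have hDl : ∀ y x, Dl y x = gorensteinPairing e J x y := fun y x => by rw [hDlg]; rfl
  have hinjD : Function.Injective (fun y => Dl y) := fun y y' hy =>
    κ.twistDualMap_injective ρ ρ' p hM hM' J he hnd ((hDlg y).symm.trans (hy.trans (hDlg y')))
  have hsurjD : Function.Surjective (fun y => Dl y) := fun z => by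
    obtain ⟨y, hy⟩ := κ.twistDualMap_surjective ρ ρ' p hM hM' J he hsurj z
    exact ⟨y, (hDlg y).trans hy⟩
  have hDeq : ∀ (g : absoluteGaloisGroup (q.adicCompletion K)) (y : Fin J → M'),
      Dl (GaloisRep.toLocal q (κ.invTwist.twistModP ρ' hM' J) g y) =
        GaloisRep.toLocal q ((κ.twistModP ρ hM J).tateDual p) g (Dl y) := fun g y => by
    rw [hDlg, hDlg]; exact hDgeq g y
  choose ginv hginv using hsurjD
  have hginv_add : ∀ z z', ginv (z + z') = ginv z + ginv z' := fun z z' =>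
    hinjD (by simp only [hginv, map_add])
  obtain ⟨Dinv, hDinv⟩ := exists_contIntertwiningMap_of_comm
    (GaloisRep.toLocal q ((κ.twistModP ρ hM J).tateDual p)) (GaloisRep.toLocal q (κ.invTwist.twistModP ρ' hM' J))
    (AddMonoidHom.mk' ginv hginv_add) (fun g z => hinjD (by
      simp only [AddMonoidHom.mk'_apply, hDeq, hginv]))
  have hDD : ∀ z, Dl (Dinv z) = z := fun z => by rw [hDinv]; exact hginv z
  -- the evaluation pairing of the local modules, retyped on the `GaloisRep.toLocal` side
  obtain ⟨P₁, hP₁, hP₁lin⟩ : ∃ P₁ : ContPairing (GaloisRep.toLocal q (κ.twistModP ρ hM J)).toTopRep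
      (GaloisRep.toLocal q ((κ.twistModP ρ hM J).tateDual p)).toTopRep
      ((DiscreteGaloisModule.mu K p).toLocal (Sum.inr q)).toTopRep,
      (∀ a b, DiscreteGaloisModule.localTatePairingZMod (κ.twistModP ρ hM J) p (Sum.inr q) (inv (Sum.inr q)) a b =
        inv (Sum.inr q) (P₁.cupProduct a b)) ∧ ∀ x f, P₁.toLin x f = f x :=
    ⟨DiscreteGaloisModule.tateDualPairingLocal (κ.twistModP ρ hM J) p (Sum.inr q), fun _ _ => rfl, fun _ _ => rfl⟩
  -- the local Tate pairing of `(a, D_* c')` is the `P`-cup product of `(a, c')`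
  have hbridge : ∀ c' : galoisCohomology (GaloisRep.toLocal q (κ.invTwist.twistModP ρ' hM' J)) 1,
      DiscreteGaloisModule.localTatePairingZMod (κ.twistModP ρ hM J) p (Sum.inr q) (inv (Sum.inr q)) c
        (galoisCohomology.map Dl 1 c') = inv (Sum.inr q) (P.cupProduct c c') := by
    intro c'
    rw [hP₁]
    refine congrArg (inv (Sum.inr q)) ?_
    have h := ContPairing.cupProduct_adjoint P₁ P (𝟙 _)
      (TopRep.ofHom ⟨Dl.toContinuousLinearMap, Dl.isIntertwining'⟩)
      (fun x y => by
        change P.toLin x y = P₁.toLin x (Dl y)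
        rw [hP, hP₁lin, hDl]) c c'
    have h1' : (cohomologyMap (𝟙 (GaloisRep.toLocal q (κ.twistModP ρ hM J)).toTopRep) 1) c = c := by
      rw [show cohomologyMap (𝟙 (GaloisRep.toLocal q (κ.twistModP ρ hM J)).toTopRep) 1 = 𝟙 _ from
        map_id_eq_id _ (fun _ => rfl) 1]
      rfl
    rw [h1'] at h
    exact h.symm
  -- every unramified class of the Tate dual pairs to zero with `c`
  have h0 : ∀ b ∈ DiscreteGaloisModule.unramifiedSubgroup (GaloisRep.toLocal q ((κ.twistModP ρ hM J).tateDual p)) 1,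
      DiscreteGaloisModule.localTatePairingZMod (κ.twistModP ρ hM J) p (Sum.inr q) (inv (Sum.inr q)) c b = 0 := by
    intro b hb
    have hc'ur : galoisCohomology.map Dinv 1 b ∈ DiscreteGaloisModule.unramifiedSubgroup
        (GaloisRep.toLocal q (κ.invTwist.twistModP ρ' hM' J)) 1 := map_mem_unramifiedSubgroup' _ _ Dinv hb
    have hbc : b = galoisCohomology.map Dl 1 (galoisCohomology.map Dinv 1 b) :=
      (map_map_eq_self_of_leftInverse _ _ Dl Dinv hDD b).symm
    obtain ⟨ψ', hψ'⟩ := oneCocycleClass_surjective _ (galoisCohomology.map Dinv 1 b)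
    have hψ'0 : ∀ t ∈ absInertia (q.adicCompletion K), ψ'.1 t = 0 :=
      (X11b.LocBridge.mem_unramifiedSubgroup_one_iff_forall_eq_zero _ hI' ψ').1 (by rw [hψ']; exact hc'ur)
    rw [hbc, hbridge, ← hψ']
    exact hcon' ψ' hψ'0
  have hID : ∀ t ∈ absInertia (q.adicCompletion K), ∀ f : DiscreteGaloisModule.TateDual K (Fin J → M) p,
      GaloisRep.toLocal q ((κ.twistModP ρ hM J).tateDual p) t f = f :=
    fun t ht f => TransverseCup.toLocal_tateDual_apply_of_mem_absInertia (κ.twistModP ρ hM J) p q rfl hqp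
      (isUnramifiedAt_twistModP ρ hM κ J q hunr hqp) ht f
  have hMn : ∀ x : Fin J → M, p • x = 0 := fun x => funext fun i => by rw [Pi.smul_apply, hM, Pi.zero_apply]
  exact hc0 (eq_zero_of_mem_transverse_of_forall_unramified_pairing_eq_zero (κ.twistModP ρ hM J) inv q
    (Ideal.absNorm q.asIdeal) hp2 hperf hMn hchar hI hID hℓM hχI hc h0)

/-- **Naturality of the `tr × ur` local cup product for an `e`-adjoint pair of coordinate endomorphisms**
(KOLY-MEMO §5.11.B (N1) on classes): at an `E`-split prime every additive `φ₀ : M → M` gives an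
equivariant `φ₀ ⊗ 1` on `𝒯_J|_q` (`toLocal_twistModP_comp_endo`), and for `e(φ₀ a, b) = e(a, φ₀′ b)` the
cup products of `(T^i[φ₂], [ψ₁])` and `(T^i[φ₁], [ψ₂])` agree whenever `φ₂(t₀) = φ₀ ∘ φ₁(t₀)` (transverse
classes) and `ψ₂(Fr) = φ₀′ ∘ ψ₁(Fr)` (unramified cocycles) — by `cupProduct_adjoint`.
[cite: NeukirchSchmidtWingberg2008, I §4 (1.4.2)] [cite: MazurRubin2004, §1.3] -/
theorem cupProduct_iterate_eq_of_adjoint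
    {e : M →+ M' →+ DiscreteGaloisModule.MuCarrier K p}
    (hunr : GaloisRep.IsUnramifiedAt q ρ) (hunr' : GaloisRep.IsUnramifiedAt q ρ')
    (hqp : (p : 𝓞 K) ∉ q.asIdeal) (hpl : p ∣ Ideal.absNorm q.asIdeal - 1)
    (hχI : ∀ u : (ZMod (Ideal.absNorm q.asIdeal))ˣ, ∃ t ∈ absInertia (q.adicCompletion K),
      modPCyclotomicCharacterZMod (q.adicCompletion K) (Ideal.absNorm q.asIdeal) t = u)
    {Fr : absoluteGaloisGroup (q.adicCompletion K)} (hFr : IsAbsArithFrob Fr)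
    (hsplit : ρ (absGaloisRestrict K (q.adicCompletion K) Fr) = 1)
    (hsplit' : ρ' (absGaloisRestrict K (q.adicCompletion K) Fr) = 1)
    {t₀ : absoluteGaloisGroup (q.adicCompletion K)} (ht₀ : t₀ ∈ absInertia (q.adicCompletion K))
    (hgen : ∀ u : (ZMod (Ideal.absNorm q.asIdeal))ˣ,
      u ∈ Subgroup.zpowers (modPCyclotomicCharacterZMod (q.adicCompletion K) (Ideal.absNorm q.asIdeal) t₀))
    (P : ContPairing (GaloisRep.toLocal q (κ.twistModP ρ hM J)).toTopRep
      (GaloisRep.toLocal q (κ.invTwist.twistModP ρ' hM' J)).toTopRep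
      ((DiscreteGaloisModule.mu K p).toLocal (Sum.inr q)).toTopRep)
    (hP : ∀ x y, P.toLin x y = gorensteinPairing e J x y)
    (S : (GaloisRep.toLocal q (κ.twistModP ρ hM J)).toContRepresentation →ⁱL
      (GaloisRep.toLocal q (κ.twistModP ρ hM J)).toContRepresentation)
    (hS : ∀ x, S x = shiftEnd M J x)
    (φ₀ : M →+ M) (φ₀' : M' →+ M') (hadj : ∀ a b, e (φ₀ a) b = e a (φ₀' b))
    (φ₁ φ₂ : contOneCocycles (GaloisRep.toLocal q (κ.twistModP ρ hM J)).toTopRep)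
    (hφ₁ : oneCocycleClass _ φ₁ ∈ DiscreteGaloisModule.transverseSubgroup (GaloisRep.toLocal q (κ.twistModP ρ hM J))
        (CyclotomicField (Ideal.absNorm q.asIdeal) (q.adicCompletion K)))
    (hφ₂ : oneCocycleClass _ φ₂ ∈ DiscreteGaloisModule.transverseSubgroup (GaloisRep.toLocal q (κ.twistModP ρ hM J))
        (CyclotomicField (Ideal.absNorm q.asIdeal) (q.adicCompletion K)))
    (hφ : φ₂.1 t₀ = fun j => φ₀ (φ₁.1 t₀ j))
    (ψ₁ ψ₂ : contOneCocycles (GaloisRep.toLocal q (κ.invTwist.twistModP ρ' hM' J)).toTopRep)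
    (hψ₁ : ∀ t ∈ absInertia (q.adicCompletion K), ψ₁.1 t = 0)
    (hψ₂ : ∀ t ∈ absInertia (q.adicCompletion K), ψ₂.1 t = 0)
    (hψ : ψ₂.1 Fr = fun j => φ₀' (ψ₁.1 Fr j)) (i : ℕ) :
    P.cupProduct ((galoisCohomology.map S 1)^[i] (oneCocycleClass _ φ₂)) (oneCocycleClass _ ψ₁) =
      P.cupProduct ((galoisCohomology.map S 1)^[i] (oneCocycleClass _ φ₁)) (oneCocycleClass _ ψ₂) := by
  classical
  have hFr1 : IsFrobPow Fr 1 := IsAbsArithFrob.isFrobPow_holds hFr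
  have hI' : ∀ t ∈ absInertia (q.adicCompletion K), ∀ y : Fin J → M',
      GaloisRep.toLocal q (κ.invTwist.twistModP ρ' hM' J) t y = y :=
    fun _ ht y => toLocal_twistModP_apply_of_mem_absInertia ρ' hM' κ.invTwist J q hunr' hqp ht y
  have hI'1 : ∀ t ∈ absInertia (q.adicCompletion K), GaloisRep.toLocal q (κ.invTwist.twistModP ρ' hM' J) t = 1 :=
    fun t ht => LinearMap.ext (hI' t ht)
  have htrivM : ∀ (g : absoluteGaloisGroup (q.adicCompletion K)) (a : M), GaloisRep.toLocal q ρ g a = a :=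
    toLocal_apply_eq_self_of_split ρ q hunr hFr1 hsplit
  have htrivM' : ∀ (g : absoluteGaloisGroup (q.adicCompletion K)) (b : M'), GaloisRep.toLocal q ρ' g b = b :=
    toLocal_apply_eq_self_of_split ρ' q hunr' hFr1 hsplit'
  obtain ⟨A, hA⟩ := exists_contIntertwiningMap_of_comm
    (GaloisRep.toLocal q (κ.twistModP ρ hM J)) (GaloisRep.toLocal q (κ.twistModP ρ hM J))
    (φ₀.compLeft (Fin J))
    (fun g x => (toLocal_twistModP_comp_endo ρ hM κ J q htrivM φ₀ g x).symm)
  obtain ⟨A', hA'⟩ := exists_contIntertwiningMap_of_comm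
    (GaloisRep.toLocal q (κ.invTwist.twistModP ρ' hM' J)) (GaloisRep.toLocal q (κ.invTwist.twistModP ρ' hM' J))
    (φ₀'.compLeft (Fin J))
    (fun g y => (toLocal_twistModP_comp_endo ρ' hM' κ.invTwist J q htrivM' φ₀' g y).symm)
  -- `T^i (H¹(A)[φ₁]) = T^i [φ₂]`: both transverse with the same value at `t₀`
  have hSit : ∀ (n : ℕ) (v : Fin J → M), (fun x => S x)^[n] v = (shiftEnd M J ^ n) v := by
    intro n v
    induction n with
    | zero => simp
    | succ n ih => rw [Function.iterate_succ_apply', ih, hS, pow_succ', Module.End.mul_apply]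
  have hXA : (galoisCohomology.map S 1)^[i] (galoisCohomology.map A 1 (oneCocycleClass _ φ₁)) =
      (galoisCohomology.map S 1)^[i] (oneCocycleClass _ φ₂) := by
    obtain ⟨φ', h1, h2⟩ := galoisCohomology_map_oneCocycleClass _ _ A φ₁
    obtain ⟨φ'', h1', h2'⟩ := map_iterate_oneCocycleClass _ S i φ'
    obtain ⟨φ₂', h1₂, h2₂⟩ := map_iterate_oneCocycleClass _ S i φ₂
    rw [h2, h2', h2₂]
    refine oneCocycleClass_eq_of_transverse_of_apply_eq ρ hM κ J q hunr hqp hpl hχI ht₀ hgen φ'' φ₂' ?_ ?_ ?_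
    · rw [← h2']; refine iterate_map_mem_transverseSubgroup _ _ S i ?_
      rw [← h2]; exact map_mem_transverseSubgroup _ _ _ A hφ₁
    · rw [← h2₂]; exact iterate_map_mem_transverseSubgroup _ _ S i hφ₂
    · rw [h1', h1₂, hSit, hSit, h1, hA, hφ]
      rfl
  have hYA : galoisCohomology.map A' 1 (oneCocycleClass _ ψ₁) = oneCocycleClass _ ψ₂ := by
    obtain ⟨ψ', h1, h2⟩ := galoisCohomology_map_oneCocycleClass _ _ A' ψ₁
    rw [h2]
    refine oneCocycleClass_eq_of_unramified_of_apply_frob_sub_mem _ hI'1 hFr ψ' ψ₂ ?_ hψ₂ (m := 0) ?_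
    · intro t ht; rw [h1, hψ₁ t ht, map_zero]
    · rw [h1, hψ, hA', map_zero, sub_zero, sub_eq_zero]; rfl
  have hcupA : ∀ (a : galoisCohomology (GaloisRep.toLocal q (κ.twistModP ρ hM J)) 1)
      (b : galoisCohomology (GaloisRep.toLocal q (κ.invTwist.twistModP ρ' hM' J)) 1),
      P.cupProduct (galoisCohomology.map A 1 a) b = P.cupProduct a (galoisCohomology.map A' 1 b) := by
    intro a b
    exact ContPairing.cupProduct_adjoint P P
      (TopRep.ofHom ⟨A.toContinuousLinearMap, A.isIntertwining'⟩)
      (TopRep.ofHom ⟨A'.toContinuousLinearMap, A'.isIntertwining'⟩)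
      (fun x y => by
        change P.toLin (A x) y = P.toLin x (A' y)
        rw [hP, hP, hA, hA']
        exact gorensteinPairing_comp_adjoint e hadj x y) a b
  -- `T^i` commutes with `H¹(A)` (both are `H¹` of equivariant maps commuting on `𝒯_J`)
  have hSA : ∀ c : galoisCohomology (GaloisRep.toLocal q (κ.twistModP ρ hM J)) 1,
      (galoisCohomology.map S 1)^[i] (galoisCohomology.map A 1 c) =
        galoisCohomology.map A 1 ((galoisCohomology.map S 1)^[i] c) := by
    intro c
    obtain ⟨φ, rfl⟩ := oneCocycleClass_surjective _ c
    obtain ⟨φa, h1, h2⟩ := galoisCohomology_map_oneCocycleClass _ _ A φ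
    obtain ⟨φas, h1', h2'⟩ := map_iterate_oneCocycleClass _ S i φa
    obtain ⟨φs, h1s, h2s⟩ := map_iterate_oneCocycleClass _ S i φ
    obtain ⟨φsa, h1sa, h2sa⟩ := galoisCohomology_map_oneCocycleClass _ _ A φs
    rw [h2, h2', h2s, h2sa]
    congr 1
    refine Subtype.ext (ContinuousMap.ext fun g => ?_)
    rw [h1', h1sa, hSit, h1, h1s, hSit, hA, hA]
    exact shiftEnd_pow_comp_apply φ₀ i _
  rw [← hXA, hSA, hcupA, hYA]

end QTerm

end Summit.BirchSwinnertonDyer.BirchSwinnertonDyer.Rank1Residual.LocalSplitPrime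

end
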